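import Mathlib
import HarnessLib
import Literature.Analysis.FluidPDE.TwoHalfNavierStokes
import Literature.Analysis.FluidPDE.ZerothLaw
import Literature.Analysis.FluidPDE.TimeAverageMeasureBasic
import Literature.Analysis.FunctionSpaces.TorusSpaceTime
import Summits.AnomalousDissipation.AnomalousDissipation.Theorems.ImpulseGridBoundedEnergyGridStubColumnarOfPlanar

/-!
# Stub `stub_columnarForwardOfPlanar` of the line `Sketch` (crux stmt-AnomalousDissipation-10430,
# `ImpulseGrid.BoundedEnergyGrid`): planar forward family ⇒ columnar forward family (axis `2`)

Registered signature (proved here, textually; `𝕋³ = UnitAddTorus (Fin 3)`,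
`E³ = EuclideanSpace ℝ (Fin 3)`, `𝕋² = UnitAddTorus (Fin 2)`, `E² = EuclideanSpace ℝ (Fin 2)` are
the skeleton's local notations, redeclared below):
```
theorem stub_columnarForwardOfPlanar :
    (∃ g : 𝕋² → E², IsSmooth g ∧ IsDivFree g ∧ HasZeroMean g ∧ g ≠ 0 ∧
      ∃ (ν : ℕ → ℝ) (v : ℕ → ℝ → 𝕋² → E²) (q : ℕ → ℝ → 𝕋² → ℝ),
        (∀ j, 0 < ν j) ∧ Tendsto ν atTop (𝓝 0) ∧
        (∀ j, IsClassicalNSSolutionOn (Ici 0) (ν j) (fun _ => g) (v j) (q j)) ∧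
        (∀ j, HasZeroMean (v j 0)) ∧
        (∀ j, ∃ C : ℝ, ∀ t, 0 ≤ t → ∫ x, ‖v j t x‖ ^ 2 ≤ C) ∧
        ∃ E : ℝ, ∀ j, meanEnergy (v j) ≤ E) →
    ∃ G : 𝕋³ → E³, IsSmooth G ∧ (∀ (s : UnitAddCircle) x, G (x + Pi.single (2 : Fin 3) s) = G x) ∧
      (∀ x, G x 2 = 0) ∧ IsDivFree G ∧ HasZeroMean G ∧ G ≠ 0 ∧
      ∃ (ν : ℕ → ℝ) (V : ℕ → ℝ → 𝕋³ → E³) (q : ℕ → ℝ → 𝕋³ → ℝ),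
        (∀ j, 0 < ν j) ∧ Tendsto ν atTop (𝓝 0) ∧
        (∀ j, IsClassicalNSSolutionOn (Ici 0) (ν j) (fun _ => G) (V j) (q j)) ∧
        (∀ j t (s : UnitAddCircle) x, V j t (x + Pi.single (2 : Fin 3) s) = V j t x) ∧
        (∀ j t x, V j t x 2 = 0) ∧ (∀ j, HasZeroMean (V j 0)) ∧
        (∀ j, ∃ C : ℝ, ∀ t, 0 ≤ t → ∫ x, ‖V j t x‖ ^ 2 ≤ C) ∧
        ∃ E : ℝ, ∀ j, meanEnergy (V j) ≤ E
```

The time-dependent analogue of the landed steady step `stub_columnarOfPlanar`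
(`Theorems/ImpulseGridBoundedEnergyGridStubColumnarOfPlanar`, whose calculus trivia
`columnarOfPlanar_*` are reused): the `2½`-dimensional lift with ZERO vertical component
(Majda–Bertozzi 2002, §2.3.1; in tree `Torus.twoHalf`, `Torus.isClassicalNSSolutionOn_twoHalf`),
slice-wise in time. A planar forward family `(g, ν_j, v_j, q_j)` gives `G := twoHalf g 0`,
`V_j t := twoHalf (v_j t) 0`, pressures `t ↦ q_j t ∘ planarProj`, the same `ν_j`, the same per-`j`
slice-energy bounds and the same mean energies. Classical on `Ici 0`:
`isClassicalNSSolutionOn_twoHalf` on the time set `Ici 0` (`uniqueDiffOn_Ici`) with `R = 0`,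
`φ = q_j` produces a classical solution whose force `twoHalfForce (Ici 0) ν_j v_j 0 q_j t` equals
`twoHalf g 0` for `t ≥ 0` by the planar momentum equation on `Ici 0` (the time derivative of the
constant zero scalar path, the gradient and the Laplacian of the zero scalar all vanish). Slice
energies agree for `t ≥ 0` (`Torus.integral_norm_sq_twoHalf`), hence the running time means agree
eventually (`timeMean_eventuallyEq`) and the mean energies coincide (`Filter.limsup_congr`).
Pure proof file (no definitions).
-/

-- `Summit.<Summit>.<Problem>` is the tree's mandated summit-side namespace (CONVENTIONS §2); for this
-- single-conjunct summit the two coincide, so the duplicate is deliberate.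
set_option linter.dupNamespace false

noncomputable section

namespace Summit.AnomalousDissipation.AnomalousDissipation.Theorems

open MeasureTheory Filter Topology Set
open Literature.Analysis.FunctionSpaces Literature.Analysis.FunctionSpaces.Torus
open Literature.Analysis.FluidPDE Literature.Analysis.FluidPDE.Torus

/-- The flat three-torus (local notation, as in the registered skeleton). -/
local notation "𝕋³" => UnitAddTorus (Fin 3)
/-- Velocity values on `T³` (local notation, as in the registered skeleton). -/
local notation "E³" => EuclideanSpace ℝ (Fin 3)
/-- The flat two-torus (local notation, as in the registered skeleton). -/
local notation "𝕋²" => UnitAddTorus (Fin 2)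
/-- Planar velocity values (local notation, as in the registered skeleton). -/
local notation "E²" => EuclideanSpace ℝ (Fin 2)

/-! ## Time-dependent `2½`-dimensional lifts with zero vertical component -/

/-- **The force of the horizontal `2½`-dimensional ansatz over a planar classical solution.**
If `v` is a classical solution of `NS_ν(g)` (constant-in-time force `g`) on the time set `S` with
pressure `q`, then for `t ∈ S` the `2½`-dimensional force `twoHalfForce S ν v 0 q t` is
`(g, 0) ∘ π` (planar part `∂ₜv + (v·∇)v - νΔv + ∇q = g` by the planar momentum equation; vertical
part `∂ₜ0 + v·∇0 - νΔ0 = 0`). [folklore] -/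
theorem columnarForward_twoHalfForce_eq {S : Set ℝ} {ν : ℝ} {g : 𝕋² → E²} {v : ℝ → 𝕋² → E²}
    {q : ℝ → 𝕋² → ℝ} (h : IsClassicalNSSolutionOn S ν (fun _ => g) v q) {t : ℝ} (ht : t ∈ S)
    (x : 𝕋³) : twoHalfForce S ν v (fun _ => (0 : 𝕋² → ℝ)) q t x = twoHalf g 0 x := by
  rw [twoHalfForce_apply]
  congr 1
  · funext y
    have hm : Torus.timeDerivWithin S v t y + Torus.convect (v t) (v t) y =
        ν • Torus.laplacian (v t) y - Torus.gradient (q t) y + g y := h.momentum t ht y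
    rw [hm]
    abel
  · funext y
    rw [columnarOfPlanar_timeDerivWithin_const, columnarOfPlanar_gradient_zero,
      columnarOfPlanar_laplacian_zero, inner_zero_right, mul_zero, Pi.zero_apply]
    ring

/-- **Planar classical solutions lift to columnar classical solutions** (slice-wise `2½`-D lift,
Majda–Bertozzi 2002, §2.3.1): if `v` is a classical solution of `NS_ν(g)` on a time set `S` of
unique differentiability with pressure `q`, then `t ↦ (v t, 0) ∘ π` is a classical solution of
`NS_ν((g, 0) ∘ π)` on `S` with pressure `t ↦ q t ∘ π` (`Torus.isClassicalNSSolutionOn_twoHalf`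
with `R = 0`, `φ = q`, its force rewritten by `columnarForward_twoHalfForce_eq`). [folklore] -/
theorem columnarForward_isClassicalNSSolutionOn_twoHalf {S : Set ℝ} (hS : UniqueDiffOn ℝ S) {ν : ℝ}
    {g : 𝕋² → E²} {v : ℝ → 𝕋² → E²} {q : ℝ → 𝕋² → ℝ}
    (h : IsClassicalNSSolutionOn S ν (fun _ => g) v q) :
    IsClassicalNSSolutionOn S ν (fun _ => twoHalf g 0) (fun t => twoHalf (v t) 0)
      (fun t => q t ∘ planarProj) := by
  have hz : IsSmooth (0 : 𝕋² → ℝ) := isSmooth_const (0 : ℝ)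
  have hcl := isClassicalNSSolutionOn_twoHalf hS ν (V := v) (R := fun _ => (0 : 𝕋² → ℝ))
    (φ := q) h.smooth_velocity (isSmoothSpaceTimeOn_const hz _) h.smooth_pressure
    (fun t ht => h.divFree t ht)
  exact
    { smooth_velocity := hcl.smooth_velocity
      smooth_pressure := hcl.smooth_pressure
      momentum := fun t ht x => by
        have hm := hcl.momentum t ht x
        rw [columnarForward_twoHalfForce_eq h ht x] at hm
        exact hm
      divFree := hcl.divFree }

/-- Slice energies of the horizontal lift: `∫‖(w, 0) ∘ π‖² = ∫‖w‖²` for smooth planar `w`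
(`Torus.integral_norm_sq_twoHalf`, the vertical contribution `∫ 0²` vanishes). [folklore] -/
theorem columnarForward_integral_norm_sq_twoHalf {w : 𝕋² → E²} (hw : IsSmooth w) :
    ∫ x, ‖twoHalf w 0 x‖ ^ 2 = ∫ y, ‖w y‖ ^ 2 := by
  rw [integral_norm_sq_twoHalf hw.continuous continuous_zero]
  simp

/-- **Mean energies of the horizontal lift of a forward field**: if `v t` is smooth for every
`t ≥ 0` then `meanEnergy (t ↦ (v t, 0) ∘ π) = meanEnergy v` (the slice energies agree for
`t ≥ 0`, so the running time means over `[0, T]` agree for `T ≥ 0`, `timeMean_eventuallyEq`, and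
the `limsup`s coincide, `Filter.limsup_congr`). [folklore] -/
theorem columnarForward_meanEnergy_twoHalf {v : ℝ → 𝕋² → E²} (hv : ∀ t, 0 ≤ t → IsSmooth (v t)) :
    meanEnergy (fun t => twoHalf (v t) 0) = meanEnergy v := by
  rw [meanEnergy_eq_longTimeAvgSup, meanEnergy_eq_longTimeAvgSup]
  unfold longTimeAvgSup
  exact Filter.limsup_congr (timeMean_eventuallyEq fun t ht =>
    columnarForward_integral_norm_sq_twoHalf (hv t ht.le))

/-- **The registered stub `stub_columnarForwardOfPlanar`**: the planar forward family lifts to the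
columnar forward family on `T³`, invariant along the axis `2` and with vanishing component `2`
(`G := twoHalf g 0`, `V_j t := twoHalf (v_j t) 0`, `t ↦ q_j t ∘ planarProj`, same `ν_j`, same
per-`j` slice-energy bounds, same `E`). [folklore] -/
theorem stub_columnarForwardOfPlanar :
    (∃ g : 𝕋² → E², IsSmooth g ∧ IsDivFree g ∧ HasZeroMean g ∧ g ≠ 0 ∧
      ∃ (ν : ℕ → ℝ) (v : ℕ → ℝ → 𝕋² → E²) (q : ℕ → ℝ → 𝕋² → ℝ),
        (∀ j, 0 < ν j) ∧ Tendsto ν atTop (𝓝 0) ∧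
        (∀ j, IsClassicalNSSolutionOn (Ici 0) (ν j) (fun _ => g) (v j) (q j)) ∧
        (∀ j, HasZeroMean (v j 0)) ∧
        (∀ j, ∃ C : ℝ, ∀ t, 0 ≤ t → ∫ x, ‖v j t x‖ ^ 2 ≤ C) ∧
        ∃ E : ℝ, ∀ j, meanEnergy (v j) ≤ E) →
    ∃ G : 𝕋³ → E³, IsSmooth G ∧ (∀ (s : UnitAddCircle) x, G (x + Pi.single (2 : Fin 3) s) = G x) ∧
      (∀ x, G x 2 = 0) ∧ IsDivFree G ∧ HasZeroMean G ∧ G ≠ 0 ∧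
      ∃ (ν : ℕ → ℝ) (V : ℕ → ℝ → 𝕋³ → E³) (q : ℕ → ℝ → 𝕋³ → ℝ),
        (∀ j, 0 < ν j) ∧ Tendsto ν atTop (𝓝 0) ∧
        (∀ j, IsClassicalNSSolutionOn (Ici 0) (ν j) (fun _ => G) (V j) (q j)) ∧
        (∀ j t (s : UnitAddCircle) x, V j t (x + Pi.single (2 : Fin 3) s) = V j t x) ∧
        (∀ j t x, V j t x 2 = 0) ∧ (∀ j, HasZeroMean (V j 0)) ∧
        (∀ j, ∃ C : ℝ, ∀ t, 0 ≤ t → ∫ x, ‖V j t x‖ ^ 2 ≤ C) ∧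
        ∃ E : ℝ, ∀ j, meanEnergy (V j) ≤ E := by
  rintro ⟨g, hg, hgdiv, hgmean, hgne, ν, v, q, hν, hν0, h, hvmean, hC, E, hE⟩
  have hvs : ∀ j t, 0 ≤ t → IsSmooth (v j t) := fun j t ht =>
    (h j).smooth_velocity.isSmooth_slice (mem_Ici.2 ht)
  have hzmean : HasZeroMean (0 : 𝕋² → ℝ) := by
    simp [HasZeroMean]
  have hzi : Integrable (0 : 𝕋² → ℝ) volume := integrable_zero _ _ _
  refine ⟨twoHalf g 0, hg.twoHalf (isSmooth_const (0 : ℝ)),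
    fun s x => columnarOfPlanar_twoHalf_add_single g 0 s x, fun x => ?_, hgdiv.twoHalf 0,
    hasZeroMean_twoHalf hg.integrable hzi hgmean hzmean, columnarOfPlanar_twoHalf_ne_zero hgne,
    ν, fun j t => twoHalf (v j t) 0, fun j t => q j t ∘ planarProj, hν, hν0,
    fun j => columnarForward_isClassicalNSSolutionOn_twoHalf (uniqueDiffOn_Ici 0) (h j),
    fun j t s x => columnarOfPlanar_twoHalf_add_single (v j t) 0 s x, fun j t x => ?_,
    fun j => hasZeroMean_twoHalf (hvs j 0 le_rfl).integrable hzi (hvmean j) hzmean,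
    fun j => ?_, E, fun j => ?_⟩
  · rw [twoHalf_apply_two, Pi.zero_apply]
  · rw [twoHalf_apply_two, Pi.zero_apply]
  · obtain ⟨C, hCj⟩ := hC j
    refine ⟨C, fun t ht => ?_⟩
    show ∫ x, ‖twoHalf (v j t) 0 x‖ ^ 2 ≤ C
    rw [columnarForward_integral_norm_sq_twoHalf (hvs j t ht)]
    exact hCj t ht
  · show meanEnergy (fun t => twoHalf (v j t) 0) ≤ E
    rw [columnarForward_meanEnergy_twoHalf (hvs j)]
    exact hE j

end Summit.AnomalousDissipation.AnomalousDissipation.Theorems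

end
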